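import Literature.NumberTheory.Automorphic.HigherGreenFunctionCMProofs
import Literature.NumberTheory.Automorphic.HyperbolicLaplaceSpectrum
import HarnessLib

/-!
# Zhang's archimedean CM height pairing: the unconditional uniqueness statement and its model

Small proved companion of `Literature/NumberTheory/Automorphic/HigherGreenFunctionCM.lean` (review
notes of p48228), now that both named facts of that file are theorems of the tree
(`resolventGreen_unique_holds` in `HigherGreenFunctionCM.lean`, `higherGreen_isResolventGreenLike_holds`
in `HigherGreenFunctionCMProofs.lean`):

* `Zhang1997.archCMHeightPairing_pair_eq`: **Zhang 1997, Prop. 4.1.2 in its interface form,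
  unconditionally** — every pairing with the properties Zhang establishes
  (`Zhang1997.ArchCMHeightPairing N k`, `N ≥ 1`, `k ≥ 2`) equals `¼ · higherGreen N k 1 x y`
  (= `½ G_k(x, y)` in Zhang's normalisation) at a CM point `x` and any `y ∉ Γ₀(N)x`;
* `Zhang1997.ArchCMHeightPairing.nonempty`: the hypothesis structure is NON-VACUOUS — the model
  `H(x, y) := ¼ · higherGreen N k 1 x y` satisfies every field;
* `realHypLaplacian_eq_re_hypLaplacian`: on `C²` functions the real hyperbolic Laplacian
  `realHypLaplacian` of `HigherGreenFunctionCM.lean` is the real part of the tree's complex-valued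
  `hypLaplacian` (`HyperbolicLaplaceSpectrum.lean`, Iwaniec (1.19)) of `ofReal ∘ F`, so the two
  normalisations of `y²(∂²/∂x² + ∂²/∂y²)` agree wherever property (a) is asked.

## References

* [Zhang1997] S.-W. Zhang, Invent. Math. 130 (1997), §3.4 (p. 132), Prop. 4.1.2.
* [Iwaniec2002] H. Iwaniec, *Spectral methods of automorphic forms*, (1.19).
-/

noncomputable section

namespace Literature.NumberTheory.Automorphic

open UpperHalfPlane Complex CongruenceSubgroup Laplacian
open scoped MatrixGroups Real

/-- **Zhang 1997, Prop. 4.1.2 (interface form), unconditional**: for `N ≥ 1`, `k ≥ 2`, any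
archimedean CM height pairing with the properties of Zhang §3.4–3.5 (`Zhang1997.ArchCMHeightPairing`),
a CM point `x` and `y ∉ Γ₀(N)x`: `H(x, y) = ¼ · higherGreen N k 1 x y` (`= ½ G_k(x, y)` with Zhang's
`G_k = Σ_{Γ₀(N)/±1} g_k`) — `zhang_heegnerCycles_height` fed with the two discharged facts
`resolventGreen_unique_holds` and `higherGreen_isResolventGreenLike_holds`.
[cite: Zhang1997, Prop. 4.1.2 (and §3.4, p. 132)] -/
theorem Zhang1997.archCMHeightPairing_pair_eq {N k : ℕ} (hN : 0 < N) (hk : 2 ≤ k)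
    (H : Zhang1997.ArchCMHeightPairing N k) {x : ℍ} {d : ℤ} (hx : IsCMPointOfDisc x d) {y : ℍ}
    (hy : y ∉ MulAction.orbit (Gamma0 N) x) :
    H.pair x y = 1 / 4 * higherGreen N k 1 x y :=
  zhang_heegnerCycles_height resolventGreen_unique_holds higherGreen_isResolventGreenLike_holds hN hk
    H hx hy

/-- **Non-vacuity of `Zhang1997.ArchCMHeightPairing`** (`N ≥ 1`, `k ≥ 2`): the model
`H(x, y) := ¼ · higherGreen N k 1 x y` — by `Zhang1997.archCMHeightPairing_pair_eq` the only
possibility off the diagonal — satisfies all recorded properties (`Γ₀(N)`-invariance, (a), (c) by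
`higherGreen_isResolventGreenLike_holds` and the symmetry of `G_k`; (b) with difference `0`).
[cite: Zhang1997, §3.4 (p. 132) and Prop. 4.1.2] -/
theorem Zhang1997.ArchCMHeightPairing.nonempty {N k : ℕ} (hN : 0 < N) (hk : 2 ≤ k) :
    Nonempty (Zhang1997.ArchCMHeightPairing N k) := by
  refine ⟨{ pair := fun x y => 1 / 4 * higherGreen N k 1 x y
            isResolventGreenLike := fun x _ _ => ?_
            sub_bounded := fun x _ _ => ⟨0, 1, one_pos, fun y _ _ => by simp⟩ }⟩
  have hsymm : (fun z => 1 / 4 * higherGreen N k 1 x z) =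
      fun z => 1 / 4 * higherGreen N k 1 z x := by
    funext z; rw [higherGreen_symm one_pos k x z]
  show IsResolventGreenLike N k x (fun z => 1 / 4 * higherGreen N k 1 x z)
  rw [hsymm]
  exact (higherGreen_isResolventGreenLike_holds N k hN hk x).1.const_mul (1 / 4)

/-- **The two hyperbolic Laplacians of the tree agree on `C²` functions**: if `F ∘ ofComplex` is
`C²` at `z` then `realHypLaplacian F z = Re (hypLaplacian (ofReal ∘ F) z)`, both being
`(Im z)² (F_xx + F_yy)(z)` (Mathlib's Laplacian commutes with the continuous linear map
`ofReal : ℝ → ℂ` on `C²` functions). [cite: Iwaniec2002, (1.19)] -/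
theorem realHypLaplacian_eq_re_hypLaplacian {F : ℍ → ℝ} {z : ℍ}
    (hF : ContDiffAt ℝ 2 (fun w : ℂ => F (ofComplex w)) (z : ℂ)) :
    realHypLaplacian F z = (hypLaplacian (fun w => (F w : ℂ)) z).re := by
  unfold realHypLaplacian hypLaplacian
  have hcomp : ((fun w : ℍ => (F w : ℂ)) ∘ ofComplex : ℂ → ℂ) =
      Complex.ofRealCLM ∘ (fun w : ℂ => F (ofComplex w)) := by
    funext w; simp
  rw [hcomp, hF.laplacian_CLM_comp_left]
  simp only [Function.comp_apply, Complex.ofRealCLM_apply]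
  rw [← Complex.ofReal_pow, ← Complex.ofReal_mul, Complex.ofReal_re]

end Literature.NumberTheory.Automorphic

end
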